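import Summits.Ventures.PercRepro.ProfileGapMonoGeneric
import Summits.Ventures.PercRepro.ProfileGapMonoGenericB

/-!
# PercRepro — THE BRIDGE BETWEEN THE TWO GENERICITY PREDICATES (p5, gen 21; p10 g8's ask, INBOX 10296)

p10's `GenericQ M z q` (finset closure `clF`) and p5's `GenericAt M z q` (set closure `M.closure`) are the same
predicate: every `X ⊆ E ∖ z` of rank `≤ q` has `z` in the closure of `E ∖ z ∖ X`.  The bridge lets either
template (`gapMonoQ_of_generic`, `gapMonoQ_of_genericAt`) be used under either hypothesis; in particular p5's
template applies at the level `u + q = ρ(E) + 1` under `GenericQ`.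

* **`genericAt_iff_genericQ`**, `gapMonoQ_of_genericQ_succ` — p5's template under p10's predicate.
-/

open scoped Matroid

namespace PercRepro.Cogirth

open Finset ThmH Skew Shadow Profile

variable {α : Type} [DecidableEq α] {M : Matroid α} [M.Finite]

/-- `GenericAt` (set closure) and `GenericQ` (finset closure) agree. -/
theorem genericAt_iff_genericQ {z : α} {q : ℕ} : GenericAt M z q ↔ GenericQ M z q := by
  unfold GenericAt GenericQ
  constructor
  · intro h X hX hr
    have := h X hX hr
    rw [← mem_coe, coe_clF]; exact this
  · intro h X hX hr
    have := h X hX hr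
    rw [← mem_coe, coe_clF] at this; exact this

/-- p5's template under p10's predicate: `(GM)_q` at a `q`-generic point with `u + q ≤ ρ(E) + 1`. -/
theorem gapMonoQ_of_genericQ_succ {z : α} {q u : ℕ} (hz : z ∈ gr M) (hz1 : rk M {z} = 1) (hg : GenericQ M z q)
    (hq : 1 ≤ q) (hqu : q < u) (hR : u + q ≤ rk M (gr M) + 1)
    (h : ProfileIneqMinusQ (M ／ ({z} : Set α)) (q - 1) (u - 1)) : GapMonoQ M z q u :=
  gapMonoQ_of_genericAt hz hz1 (genericAt_iff_genericQ.2 hg) hq hqu hR h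

end PercRepro.Cogirth
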